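import Summits.QuantumFields.YangMills.Theorems.BalabanUVNodesN09HregOfLoopSmallChi29AtRecord
import Summits.QuantumFields.YangMills.Theorems.BalabanUVNodesN09TransportPositiveOfLocalRoute
import Summits.QuantumFields.YangMills.Theorems.BalabanUVNodesN09FibreIntegralContinuousOfChartRegularity
import Summits.QuantumFields.YangMills.Theorems.BalabanUVNodesN09GaugeFixingTermContinuousOnAdmissible
import HarnessLib

/-!
# BalabanUVNodes ∕ N09 — THE REGULARITY TOWER ON THE LOCAL ROUTE (ROAD B): by induction on the step, `A_j` continuous on every `domAlt_j`, `hreg_j` and (F3)_j for all `j < K`,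
# from (H-U), (I19), [B11] solvability on the domains, the critical configurations continuous ON the next domains, and NUMERICS — no fibred chart, no Jacobian section, no a.e. socket;
# dag-n09-w4 g3's door with the analytic inclusion `hreg` REPLACED by those inputs

Cell `pub-ymgap`, width seat `pub-ymgap-dag-n09-w2` generation 5 (HUMAN RULING D-0149; DAG node N09 = [Balaban1987RG1] §§2–5; INBOX INTENT-6 under CLAIM-2 l.37354 ∕ l.38014 ∕ l.38603).
`--kind proof --supports stmt-QuantumFields-27364 --as helper` (K1⁹ `StabilityBRunRowsAtRecordR13SepCoPHV`; count-neutral; theorems only, 0 def ∕ 0 instance ∕ 0 notation ∕ 0 sorry).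

WHY.  The β-recursion [I] (0.19) `A_{k+1} = log(𝐍_k⁻¹·T_kρ_k)` is read ON the small-field domains; the regularity of `A_{k+1}` on `domAlt_{k+1}` needs `hreg_k` and (F3)_k, and
`ρ_k = χ^{(2.9)}_k·exp[−GF_k∕g_k² + A_k]` reads `A_k` — an induction.  dag-n09-w1 g5 ran it on ROAD A (`…N09RegularityTowerOfChartRegularity`, per-step fibred charts).  THIS FILE runs it on
ROAD B, where every step input is now a theorem of LOCAL data: `hreg_k` = this seat's `…N09HregOfLoopSmallChi29AtRecord.regularOn_domAlt_betaInputOfRecord_of_localSupportSet` (dag-n09-w3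
g6's localised door + local support set + this seat's continuity supplier), (F3)_k = this seat's `…N09TransportPositiveOfLocalRoute` at the witness `V^{(k)}(V)` — which lies in the
INTERIOR of the local support set by dag-n09-w3 g6's `hρK_betaInputOfRecord_of_hsolν_of_numerics`, since `Ū(V^{(k)}(V)) = V ∈ domAlt_{k+1}` and `ρ_k` is positive at it —, the corner =
dag-n09-w1 g5's `continuousOn_effActionHT_succ_of_subset_regSetOfRecord_of_pos`, the base = their `continuousOn_effActionHT_zero`, `GF_j` continuous on `domAlt_j` = their
`continuousOn_gfOfRecord_domAlt` (numerics) in the door edition.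

WHAT IS PROVED (theorems only).
§1 at the Stage-13 letters (`θ₀`, torus `K`, history `g`, transport `TcanOfRecord`): ★★ `hreg_pos_contA_of_localSupportSet` (THE STEP), ★★★ `continuousOn_effActionHT_all_of_localSupportSet`
   (THE TOWER, `∀ j ≤ K`), ★★★ `hreg_pos_all_of_localSupportSet` (`∀ j < K`, `hreg_j` ∧ (F3)_j).
§2 at the Stage-13 record of a run `P`: ★★ `hreg_of_localRoute` (the N09 doors' binder VERBATIM), ★★ `pos_of_localRoute`, ★★ `normConst_pos_and_eq_exp_of_localRoute`.
§3 ★★★ `thm3Member_stage13SepCoPH_atDomAlt_of_localRoute_of_numerics_of_εreg_eq` — dag-n09-w4 g3's door `…N09B0RiderAtRecord.thm3Member_stage13SepCoPH_atDomAlt_of_numerics_of_εreg_eq` with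
   `hreg` GONE; `GF_j`'s continuity supplied by dag-n09-w1 g5's `continuousOn_gfOfRecord_domAlt`.

DISPLAYED (never asserted): (H-U) `hρm` and (I19) `hint` for every `ρ_j`; [B11] solvability on the domains (`hsolν`); `hcrit : ∀ j < K, ContinuousOn (critCfgOfRecord θ.ν K j) domAlt_{j+1}`
(N07 ∕ dag-n09-w1 g6's `hcritSel_…` for the Sel edition; NO supplier for the bare `Classical.choose` background — dag-n09-w3 g6's crit-parametric CLAIM-3); `GF_j` continuous on `domAlt_j` (§1–§2;
derived in §3); NUMERICS: `0 < εreg`, [B7] ×2, `0 < ε₂₉`, rider ×2, `(((d+2)L)²∕4)·B < α ≤ 1∕24`, `α < δ_N`, `157·α < L^{1−d}`, STRICT `B < ε₀`, `0 < ε₀`, and for `GF`: `((d·L)²∕4)·ε₀ < δ_Fed`.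

HONEST FRAMING.  Kernel induction BY NAME; NOTHING of Bałaban's asserted; `hreg`∕(F3)∕`contTOn` RE-SHAPED to the displayed inputs, NOT discharged; N09 NOT discharged; conjunct 1 (Lemma 4) ∕
FLAG №7 untouched; K0⁷ ∕ K1⁹ ∕ K2⁹ ∕ K3⁸ NOT closed; counts unmoved (typed 28∕28 · discharged 5∕28); no summit statement is proved here; R4 = the conditional finite-𝕋⁴ rung
`BalabanLadder.UV` only — NOT continuum ∕ ℝ⁴ ∕ OS; the Yang–Mills mass gap (Clay) is NOT proved by any of this.
-/

noncomputable section

open Filter Topology Set Function MeasureTheory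
open scoped ENNReal NNReal

namespace Summit.QuantumFields.YangMills.BalabanUVNodes.N09RegularityTowerOfLocalRoute

open Literature.MathematicalPhysics.QuantumFieldTheory.Balaban1983to89
open Literature.MathematicalPhysics.QuantumFieldTheory.Balaban1983to89.Node00
open Literature.MathematicalPhysics.QuantumFieldTheory.Balaban1983to89.T4Continuum (T4Family)
open Literature.MathematicalPhysics.QuantumFieldTheory.Balaban1983to89.DagBinding (WorldP leavesP)
open Literature.MathematicalPhysics.QuantumFieldTheory.Balaban1983to89.B12RTGaugeInvariance254 (liftTransf)
open Literature.MathematicalPhysics.QuantumFieldTheory.Balaban1983to89.GaugeField (gaugeAct)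
open Literature.MathematicalPhysics.QuantumFieldTheory.Balaban1983to89.BlockAveraging (Small Idx loopHol)
open Literature.MathematicalPhysics.QuantumFieldTheory.Balaban1983to89.ExpMeanLog (expMeanLogSU deltaSU)
open Literature.MathematicalPhysics.QuantumFieldTheory.Balaban1983to89.FederbushMean (deltaFed)
open Literature.MathematicalPhysics.QuantumFieldTheory.Balaban1983to89.B12Eq019ActionBody (normConst_mul_exp_nextAction)
open Literature.MathematicalPhysics.QuantumFieldTheory.Balaban1983to89.B12ContinuousTransportInvarianceOn (isOpen_domAltOfRecord)
open Summit.QuantumFields.YangMills.BalabanUVNodes.N09TransportPositiveOnDomainOfFibredChart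
  (betaInput_chi29_critCfgOfRecord_pos continuousOn_effActionHT_succ_of_subset_regSetOfRecord_of_pos)
open Summit.QuantumFields.YangMills.BalabanUVNodes.N09FibreIntegralContinuousOfChartRegularity (continuousOn_effActionHT_zero)
open Summit.QuantumFields.YangMills.BalabanUVNodes.N09ChartReadAveragingSmooth (continuousAt_avgFun_of_small)
open Summit.QuantumFields.YangMills.BalabanUVNodes.N09LocalSupportSetAtRecord
  (hρK_betaInputOfRecord_of_hsolν_of_numerics localSupportSet_subset_domAlt localSupportSet_subset_loopGuard)
open Summit.QuantumFields.YangMills.BalabanUVNodes.N09HregOfLoopSmallChi29AtRecord (regularOn_domAlt_betaInputOfRecord_of_localSupportSet)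
open Summit.QuantumFields.YangMills.BalabanUVNodes.N09TransportPositiveOfLocalRoute (TcanOfRecord_betaInput_chi29_pos_of_localRoute)
open Summit.QuantumFields.YangMills.BalabanUVNodes.N09GaugeFixingTermContinuousOnAdmissible (continuousOn_gfOfRecord_domAlt)
open Summit.QuantumFields.YangMills.BalabanUVNodes.N09B0RiderAtRecord (thm3Member_stage13SepCoPH_atDomAlt_of_numerics_of_εreg_eq)

variable {F : T4Family} {N : ℕ} [NeZero N]

/-! ## §1 At the Stage-13 letters: the step, the tower, `hreg_j` ∧ (F3)_j for all `j < K` -/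

section Tower

variable (θ₀ : Stage13Params F N) (K : ℕ) (g : ℕ → ℝ)

/-- ★★ **THE STEP ON THE LOCAL ROUTE** (`T = TcanOfRecord`, `χ = chiβOfRecord₁₃ θ₀ = chiFixed29 θ₀.ν θ₀.ε₂₉`, `j < K`).  From `ContinuousOn A_j domAlt_j` (the induction hypothesis) and:
(H-U) `hρm`, (I19) `hint`, [B11] solvability on the domains (`hsolν`), `hcrit : ContinuousOn (critCfgOfRecord θ₀.ν K j) domAlt_{j+1}`, `GF_j` continuous on `domAlt_j`, and numerics:
**`hreg_j`** (`regularOn_domAlt_betaInputOfRecord_of_localSupportSet`), **(F3)_j** (`TcanOfRecord_betaInput_chi29_pos_of_localRoute` at the witness `V^{(j)}(V)`, which lies in the interior of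
the local support set — `hρK_betaInputOfRecord_of_hsolν_of_numerics` — hence in the loop guard and in `domAlt_j`), and **`ContinuousOn A_{j+1} domAlt_{j+1}`** (dag-n09-w1 g5's corner).
[cite: Balaban1987RG1, (0.19) p.255, p.259, (2.3) p.265, (2.9) p.266 and (2.10) p.267] -/
theorem hreg_pos_contA_of_localSupportSet {j : ℕ} (hj : j < K)
    (hεreg : 0 < θ₀.ν.εreg)
    (hε3 : (143 * (((((F.P K).d + 4 : ℕ) : ℝ)) ^ 2 / 4) ^ 2) * θ₀.ν.εreg ≤ 1 / 3)
    (hε2 : 2 * θ₀.ν.εreg ≤ 2 * deltaSU (Fin N) / ((((F.P K).d + 4) * (F.P K).L : ℕ) : ℝ) ^ 2) (hε29 : 0 < θ₀.ε₂₉)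
    (hn1 : 1640 * (2 * (((((F.P K).d + 2) * (F.P K).L : ℕ) : ℝ) * θ₀.ε₂₉) +
        ((((F.P K).d + 2) * (F.P K).L : ℕ) : ℝ) ^ 2 / 4 * (2 * θ₀.ν.εreg / ((F.P K).L : ℝ) ^ 2)) * (((F.P K).L : ℝ) ^ ((F.P K).d - 1)) ^ 2 ≤ 1)
    (hn2 : 13 * (2 * (((((F.P K).d + 2) * (F.P K).L : ℕ) : ℝ) * θ₀.ε₂₉) +
        ((((F.P K).d + 2) * (F.P K).L : ℕ) : ℝ) ^ 2 / 4 * (2 * θ₀.ν.εreg / ((F.P K).L : ℝ) ^ 2)) * ((F.P K).L : ℝ) ^ ((F.P K).d - 1) < deltaSU (Fin N))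
    {α : ℝ} (hαB : ((((F.P K).d + 2) * (F.P K).L : ℕ) : ℝ) ^ 2 / 4 *
      (2 * θ₀.ν.εreg / ((F.P K).L : ℝ) ^ 2 + 4 * max θ₀.ε₂₉ (10 * (((((F.P K).d + 2) * (F.P K).L : ℕ) : ℝ) * θ₀.ε₂₉) * ((F.P K).L : ℝ) ^ ((F.P K).d - 1))) < α)
    (hα24 : α ≤ 1 / 24) (hαδ : α < deltaSU (Fin N)) (hαL : 157 * α < (((F.P K).L : ℝ) ^ ((F.P K).d - 1))⁻¹)
    (hord : 2 * θ₀.ν.εreg / ((F.P K).L : ℝ) ^ 2 +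
      4 * max θ₀.ε₂₉ (10 * (((((F.P K).d + 2) * (F.P K).L : ℕ) : ℝ) * θ₀.ε₂₉) * ((F.P K).L : ℝ) ^ ((F.P K).d - 1)) < θ₀.ν.ε₀)
    (hρm : Measurable (betaInputOfRecord F N (TcanOfRecord F N) (chiβOfRecord₁₃ F N θ₀) K g j))
    (hint : Integrable (betaInputOfRecord F N (TcanOfRecord F N) (chiβOfRecord₁₃ F N θ₀) K g j) (fieldMeasure (F.P K) j (SU N)))
    (hsolν : ∀ j < K, ∀ W ∈ domAltOfRecord F N θ₀.ν K (j + 1), UkExists F N K (j + 1) θ₀.ν.εreg W)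
    (hcrit : ContinuousOn (critCfgOfRecord F N θ₀.ν K j) (domAltOfRecord F N θ₀.ν K (j + 1)))
    (hGF : ContinuousOn (gfOfRecord F N K j) (domAltOfRecord F N θ₀.ν K j))
    (hA : ContinuousOn (effActionHT F N (TcanOfRecord F N) (chiβOfRecord₁₃ F N θ₀) K g j) (domAltOfRecord F N θ₀.ν K j)) :
    domAltOfRecord F N θ₀.ν K (j + 1) ⊆ regSetOfRecord F N K j (betaInputOfRecord F N (TcanOfRecord F N) (chiβOfRecord₁₃ F N θ₀) K g j) ∧
      (∀ V ∈ domAltOfRecord F N θ₀.ν K (j + 1), 0 < TcanOfRecord F N K j (betaInputOfRecord F N (TcanOfRecord F N) (chiβOfRecord₁₃ F N θ₀) K g j) V) ∧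
      ContinuousOn (effActionHT F N (TcanOfRecord F N) (chiβOfRecord₁₃ F N θ₀) K g (j + 1)) (domAltOfRecord F N θ₀.ν K (j + 1)) := by
  have hDj := isOpen_domAltOfRecord (F := F) (N := N) θ₀.ν K j
  have hDj1 := isOpen_domAltOfRecord (F := F) (N := N) θ₀.ν K (j + 1)
  have hreg := (regularOn_domAlt_betaInputOfRecord_of_localSupportSet θ₀ K g (TcanOfRecord F N) hj hεreg hε3 hε2 hε29 hn1 hn2 hαB hα24 hαδ hαL hord hρm hint
    hsolν hcrit hGF hA).1
  have hpos : ∀ V ∈ domAltOfRecord F N θ₀.ν K (j + 1),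
      0 < TcanOfRecord F N K j (betaInputOfRecord F N (TcanOfRecord F N) (chiβOfRecord₁₃ F N θ₀) K g j) V := by
    intro V hV
    have hsol := hsolν j hj V hV
    -- the witness `V^{(j)}(V)`: in the fibre over `V ∈ domAlt_{j+1}`, `ρ_j` positive at it, hence in the interior of the local support set
    have havgV : (avOfRecord F N K j).avg (critCfgOfRecord F N θ₀.ν K j V) ∈ domAltOfRecord F N θ₀.ν K (j + 1) := by
      rw [avg_critCfgOfRecord hsol]; exact hV
    have hmem := interior_subset (hρK_betaInputOfRecord_of_hsolν_of_numerics θ₀ K g (TcanOfRecord F N) hεreg hε3 hε2 hε29.le hn1 hn2 hαB hsolν j hj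
      (critCfgOfRecord F N θ₀.ν K j V) havgV (betaInput_chi29_critCfgOfRecord_pos θ₀.ν hε29 (TcanOfRecord F N) K g hsol).ne')
    have hUα : ∀ c (i : Idx (F.P K)), dist1 (loopHol (critCfgOfRecord F N θ₀.ν K j V) c i) ≤ α :=
      localSupportSet_subset_loopGuard (F := F) (N := N) K j _ hmem
    have hmemdom : critCfgOfRecord F N θ₀.ν K j V ∈ domAltOfRecord F N θ₀.ν K j := localSupportSet_subset_domAlt θ₀ K j hord hmem
    -- the critical letters are continuous at the witness: on-domain hcrit composed with the averaging, continuous at guard points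
    have hsmall : ∀ c, Small (expMeanLogSU (n := Fin N)) (critCfgOfRecord F N θ₀.ν K j V) c := fun c i => lt_of_le_of_lt (hUα c i) hαδ
    have hcritU : ContinuousAt (fun U : GaugeField (F.P K) j (SU N) => critCfgOfRecord F N θ₀.ν K j ((avOfRecord F N K j).avg U))
        (critCfgOfRecord F N θ₀.ν K j V) :=
      ContinuousAt.comp (f := (avOfRecord F N K j).avg) (hcrit.continuousAt (hDj1.mem_nhds havgV))
        (continuousAt_avgFun_of_small (P := F.P K) (j := j) _ hsmall)
    exact TcanOfRecord_betaInput_chi29_pos_of_localRoute θ₀.ν hε29 (TcanOfRecord F N) g hj hα24 hαδ hαL hρm hint hsol hUα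
      (fun b _ => (continuous_apply b).continuousAt.comp hcritU) (hGF.continuousAt (hDj.mem_nhds hmemdom)) (hA.continuousAt (hDj.mem_nhds hmemdom)) (hreg hV)
  exact ⟨hreg, hpos, continuousOn_effActionHT_succ_of_subset_regSetOfRecord_of_pos (chiβOfRecord₁₃ F N θ₀) K g j hreg hpos⟩

/-- ★★★ **THE TOWER ON THE LOCAL ROUTE: `A_j` IS CONTINUOUS ON `domAlt_j` FOR EVERY `j ≤ K`** (induction on `j`: base `continuousOn_effActionHT_zero`, step `hreg_pos_contA_of_localSupportSet`),
from (H-U), (I19), `hsolν`, on-domain `hcrit`, `GF_j` continuity on the domains and numerics. [cite: Balaban1987RG1, (0.17)–(0.19) p.255, p.259, (2.9) p.266 and (2.10) p.267] -/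
theorem continuousOn_effActionHT_all_of_localSupportSet (hεreg : 0 < θ₀.ν.εreg)
    (hε3 : (143 * (((((F.P K).d + 4 : ℕ) : ℝ)) ^ 2 / 4) ^ 2) * θ₀.ν.εreg ≤ 1 / 3)
    (hε2 : 2 * θ₀.ν.εreg ≤ 2 * deltaSU (Fin N) / ((((F.P K).d + 4) * (F.P K).L : ℕ) : ℝ) ^ 2) (hε29 : 0 < θ₀.ε₂₉)
    (hn1 : 1640 * (2 * (((((F.P K).d + 2) * (F.P K).L : ℕ) : ℝ) * θ₀.ε₂₉) +
        ((((F.P K).d + 2) * (F.P K).L : ℕ) : ℝ) ^ 2 / 4 * (2 * θ₀.ν.εreg / ((F.P K).L : ℝ) ^ 2)) * (((F.P K).L : ℝ) ^ ((F.P K).d - 1)) ^ 2 ≤ 1)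
    (hn2 : 13 * (2 * (((((F.P K).d + 2) * (F.P K).L : ℕ) : ℝ) * θ₀.ε₂₉) +
        ((((F.P K).d + 2) * (F.P K).L : ℕ) : ℝ) ^ 2 / 4 * (2 * θ₀.ν.εreg / ((F.P K).L : ℝ) ^ 2)) * ((F.P K).L : ℝ) ^ ((F.P K).d - 1) < deltaSU (Fin N))
    {α : ℝ} (hαB : ((((F.P K).d + 2) * (F.P K).L : ℕ) : ℝ) ^ 2 / 4 *
      (2 * θ₀.ν.εreg / ((F.P K).L : ℝ) ^ 2 + 4 * max θ₀.ε₂₉ (10 * (((((F.P K).d + 2) * (F.P K).L : ℕ) : ℝ) * θ₀.ε₂₉) * ((F.P K).L : ℝ) ^ ((F.P K).d - 1))) < α)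
    (hα24 : α ≤ 1 / 24) (hαδ : α < deltaSU (Fin N)) (hαL : 157 * α < (((F.P K).L : ℝ) ^ ((F.P K).d - 1))⁻¹)
    (hord : 2 * θ₀.ν.εreg / ((F.P K).L : ℝ) ^ 2 +
      4 * max θ₀.ε₂₉ (10 * (((((F.P K).d + 2) * (F.P K).L : ℕ) : ℝ) * θ₀.ε₂₉) * ((F.P K).L : ℝ) ^ ((F.P K).d - 1)) < θ₀.ν.ε₀)
    (hρm : ∀ j < K, Measurable (betaInputOfRecord F N (TcanOfRecord F N) (chiβOfRecord₁₃ F N θ₀) K g j))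
    (hint : ∀ j < K, Integrable (betaInputOfRecord F N (TcanOfRecord F N) (chiβOfRecord₁₃ F N θ₀) K g j) (fieldMeasure (F.P K) j (SU N)))
    (hsolν : ∀ j < K, ∀ W ∈ domAltOfRecord F N θ₀.ν K (j + 1), UkExists F N K (j + 1) θ₀.ν.εreg W)
    (hcrit : ∀ j < K, ContinuousOn (critCfgOfRecord F N θ₀.ν K j) (domAltOfRecord F N θ₀.ν K (j + 1)))
    (hGF : ∀ j < K, ContinuousOn (gfOfRecord F N K j) (domAltOfRecord F N θ₀.ν K j)) :
    ∀ j, j ≤ K → ContinuousOn (effActionHT F N (TcanOfRecord F N) (chiβOfRecord₁₃ F N θ₀) K g j) (domAltOfRecord F N θ₀.ν K j)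
  | 0, _ => continuousOn_effActionHT_zero _ _ K g _
  | j + 1, hj => by
    have hjK : j < K := Nat.lt_of_succ_le hj
    have ih := continuousOn_effActionHT_all_of_localSupportSet hεreg hε3 hε2 hε29 hn1 hn2 hαB hα24 hαδ hαL hord hρm hint hsolν hcrit hGF j hjK.le
    exact (hreg_pos_contA_of_localSupportSet θ₀ K g hjK hεreg hε3 hε2 hε29 hn1 hn2 hαB hα24 hαδ hαL hord (hρm j hjK) (hint j hjK) hsolν (hcrit j hjK)
      (hGF j hjK) ih).2.2

/-- ★★★ **… HENCE `hreg_j` AND (F3)_j FOR EVERY `j < K` ON THE LOCAL ROUTE**: `domAlt_{j+1} ⊆ regSetOfRecord K j ρ_j` and `0 < TcanOfRecord K j ρ_j V` at every `V ∈ domAlt_{j+1}`.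
[cite: Balaban1987RG1, p.259, (0.19) p.255 and (2.10) p.267] -/
theorem hreg_pos_all_of_localSupportSet (hεreg : 0 < θ₀.ν.εreg)
    (hε3 : (143 * (((((F.P K).d + 4 : ℕ) : ℝ)) ^ 2 / 4) ^ 2) * θ₀.ν.εreg ≤ 1 / 3)
    (hε2 : 2 * θ₀.ν.εreg ≤ 2 * deltaSU (Fin N) / ((((F.P K).d + 4) * (F.P K).L : ℕ) : ℝ) ^ 2) (hε29 : 0 < θ₀.ε₂₉)
    (hn1 : 1640 * (2 * (((((F.P K).d + 2) * (F.P K).L : ℕ) : ℝ) * θ₀.ε₂₉) +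
        ((((F.P K).d + 2) * (F.P K).L : ℕ) : ℝ) ^ 2 / 4 * (2 * θ₀.ν.εreg / ((F.P K).L : ℝ) ^ 2)) * (((F.P K).L : ℝ) ^ ((F.P K).d - 1)) ^ 2 ≤ 1)
    (hn2 : 13 * (2 * (((((F.P K).d + 2) * (F.P K).L : ℕ) : ℝ) * θ₀.ε₂₉) +
        ((((F.P K).d + 2) * (F.P K).L : ℕ) : ℝ) ^ 2 / 4 * (2 * θ₀.ν.εreg / ((F.P K).L : ℝ) ^ 2)) * ((F.P K).L : ℝ) ^ ((F.P K).d - 1) < deltaSU (Fin N))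
    {α : ℝ} (hαB : ((((F.P K).d + 2) * (F.P K).L : ℕ) : ℝ) ^ 2 / 4 *
      (2 * θ₀.ν.εreg / ((F.P K).L : ℝ) ^ 2 + 4 * max θ₀.ε₂₉ (10 * (((((F.P K).d + 2) * (F.P K).L : ℕ) : ℝ) * θ₀.ε₂₉) * ((F.P K).L : ℝ) ^ ((F.P K).d - 1))) < α)
    (hα24 : α ≤ 1 / 24) (hαδ : α < deltaSU (Fin N)) (hαL : 157 * α < (((F.P K).L : ℝ) ^ ((F.P K).d - 1))⁻¹)
    (hord : 2 * θ₀.ν.εreg / ((F.P K).L : ℝ) ^ 2 +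
      4 * max θ₀.ε₂₉ (10 * (((((F.P K).d + 2) * (F.P K).L : ℕ) : ℝ) * θ₀.ε₂₉) * ((F.P K).L : ℝ) ^ ((F.P K).d - 1)) < θ₀.ν.ε₀)
    (hρm : ∀ j < K, Measurable (betaInputOfRecord F N (TcanOfRecord F N) (chiβOfRecord₁₃ F N θ₀) K g j))
    (hint : ∀ j < K, Integrable (betaInputOfRecord F N (TcanOfRecord F N) (chiβOfRecord₁₃ F N θ₀) K g j) (fieldMeasure (F.P K) j (SU N)))
    (hsolν : ∀ j < K, ∀ W ∈ domAltOfRecord F N θ₀.ν K (j + 1), UkExists F N K (j + 1) θ₀.ν.εreg W)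
    (hcrit : ∀ j < K, ContinuousOn (critCfgOfRecord F N θ₀.ν K j) (domAltOfRecord F N θ₀.ν K (j + 1)))
    (hGF : ∀ j < K, ContinuousOn (gfOfRecord F N K j) (domAltOfRecord F N θ₀.ν K j)) :
    ∀ j < K, domAltOfRecord F N θ₀.ν K (j + 1) ⊆ regSetOfRecord F N K j (betaInputOfRecord F N (TcanOfRecord F N) (chiβOfRecord₁₃ F N θ₀) K g j) ∧
      ∀ V ∈ domAltOfRecord F N θ₀.ν K (j + 1), 0 < TcanOfRecord F N K j (betaInputOfRecord F N (TcanOfRecord F N) (chiβOfRecord₁₃ F N θ₀) K g j) V := by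
  intro j hj
  have h := hreg_pos_contA_of_localSupportSet θ₀ K g hj hεreg hε3 hε2 hε29 hn1 hn2 hαB hα24 hαδ hαL hord (hρm j hj) (hint j hj) hsolν (hcrit j hj) (hGF j hj)
    (continuousOn_effActionHT_all_of_localSupportSet θ₀ K g hεreg hε3 hε2 hε29 hn1 hn2 hαB hα24 hαδ hαL hord hρm hint hsolν hcrit hGF j hj.le)
  exact ⟨h.1, h.2.1⟩

end Tower

/-! ## §2 At the Stage-13 record of a run `P` (`TβOfRecord₁₃ = TcanOfRecord`, `gOfRecord₁₃ θ P`) -/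

section Record

variable (θ : Stage13Params F N) (P : B12.RunParams)

/-- **★★ THE DOORS' ANALYTIC INCLUSION `hreg` AT THE STAGE-13 RECORD ON THE LOCAL ROUTE, `A_j` SUPPLIED BY THE TOWER**: `∀ j < P.K, domAltOfRecord θ.ν P.K (j+1) ⊆ regSetOfRecord P.K j ρ_j` —
the binder of the N09 doors VERBATIM — from (H-U), (I19), `hsolν`, on-domain `hcrit`, `GF_j` continuity on the domains, numerics. [cite: Balaban1987RG1, p.259, (2.10) p.267 and (0.13) p.254] -/
theorem hreg_of_localRoute (hεreg : 0 < θ.ν.εreg)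
    (hε3 : (143 * (((((F.P P.K).d + 4 : ℕ) : ℝ)) ^ 2 / 4) ^ 2) * θ.ν.εreg ≤ 1 / 3)
    (hε2 : 2 * θ.ν.εreg ≤ 2 * deltaSU (Fin N) / ((((F.P P.K).d + 4) * (F.P P.K).L : ℕ) : ℝ) ^ 2) (hε29 : 0 < θ.ε₂₉)
    (hn1 : 1640 * (2 * (((((F.P P.K).d + 2) * (F.P P.K).L : ℕ) : ℝ) * θ.ε₂₉) +
        ((((F.P P.K).d + 2) * (F.P P.K).L : ℕ) : ℝ) ^ 2 / 4 * (2 * θ.ν.εreg / ((F.P P.K).L : ℝ) ^ 2)) * (((F.P P.K).L : ℝ) ^ ((F.P P.K).d - 1)) ^ 2 ≤ 1)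
    (hn2 : 13 * (2 * (((((F.P P.K).d + 2) * (F.P P.K).L : ℕ) : ℝ) * θ.ε₂₉) +
        ((((F.P P.K).d + 2) * (F.P P.K).L : ℕ) : ℝ) ^ 2 / 4 * (2 * θ.ν.εreg / ((F.P P.K).L : ℝ) ^ 2)) * ((F.P P.K).L : ℝ) ^ ((F.P P.K).d - 1) < deltaSU (Fin N))
    {α : ℝ} (hαB : ((((F.P P.K).d + 2) * (F.P P.K).L : ℕ) : ℝ) ^ 2 / 4 *
      (2 * θ.ν.εreg / ((F.P P.K).L : ℝ) ^ 2 + 4 * max θ.ε₂₉ (10 * (((((F.P P.K).d + 2) * (F.P P.K).L : ℕ) : ℝ) * θ.ε₂₉) * ((F.P P.K).L : ℝ) ^ ((F.P P.K).d - 1))) < α)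
    (hα24 : α ≤ 1 / 24) (hαδ : α < deltaSU (Fin N)) (hαL : 157 * α < (((F.P P.K).L : ℝ) ^ ((F.P P.K).d - 1))⁻¹)
    (hord : 2 * θ.ν.εreg / ((F.P P.K).L : ℝ) ^ 2 +
      4 * max θ.ε₂₉ (10 * (((((F.P P.K).d + 2) * (F.P P.K).L : ℕ) : ℝ) * θ.ε₂₉) * ((F.P P.K).L : ℝ) ^ ((F.P P.K).d - 1)) < θ.ν.ε₀)
    (hρm : ∀ j < P.K, Measurable (betaInputOfRecord F N (TβOfRecord₁₃ F N) (chiβOfRecord₁₃ F N θ) P.K (gOfRecord₁₃ F N θ P) j))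
    (hint : ∀ j < P.K, Integrable (betaInputOfRecord F N (TβOfRecord₁₃ F N) (chiβOfRecord₁₃ F N θ) P.K (gOfRecord₁₃ F N θ P) j) (fieldMeasure (F.P P.K) j (SU N)))
    (hsolν : ∀ j < P.K, ∀ W ∈ domAltOfRecord F N θ.ν P.K (j + 1), UkExists F N P.K (j + 1) θ.ν.εreg W)
    (hcrit : ∀ j < P.K, ContinuousOn (critCfgOfRecord F N θ.ν P.K j) (domAltOfRecord F N θ.ν P.K (j + 1)))
    (hGF : ∀ j < P.K, ContinuousOn (gfOfRecord F N P.K j) (domAltOfRecord F N θ.ν P.K j)) :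
    ∀ j < P.K, domAltOfRecord F N θ.ν P.K (j + 1) ⊆
      regSetOfRecord F N P.K j (betaInputOfRecord F N (TβOfRecord₁₃ F N) (chiβOfRecord₁₃ F N θ) P.K (gOfRecord₁₃ F N θ P) j) :=
  fun j hj => (hreg_pos_all_of_localSupportSet θ P.K (gOfRecord₁₃ F N θ P) hεreg hε3 hε2 hε29 hn1 hn2 hαB hα24 hαδ hαL hord hρm hint hsolν hcrit hGF j hj).1

/-- **★★ (F3) ON EVERY DOMAIN AT THE STAGE-13 RECORD** from the same data: `0 < TβOfRecord₁₃ P.K j ρ_j V` at every `V ∈ domAltOfRecord θ.ν P.K (j+1)`, every `j < P.K`.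
[cite: Balaban1987RG1, (0.19) p.255, p.259 and (2.10) p.267] -/
theorem pos_of_localRoute (hεreg : 0 < θ.ν.εreg)
    (hε3 : (143 * (((((F.P P.K).d + 4 : ℕ) : ℝ)) ^ 2 / 4) ^ 2) * θ.ν.εreg ≤ 1 / 3)
    (hε2 : 2 * θ.ν.εreg ≤ 2 * deltaSU (Fin N) / ((((F.P P.K).d + 4) * (F.P P.K).L : ℕ) : ℝ) ^ 2) (hε29 : 0 < θ.ε₂₉)
    (hn1 : 1640 * (2 * (((((F.P P.K).d + 2) * (F.P P.K).L : ℕ) : ℝ) * θ.ε₂₉) +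
        ((((F.P P.K).d + 2) * (F.P P.K).L : ℕ) : ℝ) ^ 2 / 4 * (2 * θ.ν.εreg / ((F.P P.K).L : ℝ) ^ 2)) * (((F.P P.K).L : ℝ) ^ ((F.P P.K).d - 1)) ^ 2 ≤ 1)
    (hn2 : 13 * (2 * (((((F.P P.K).d + 2) * (F.P P.K).L : ℕ) : ℝ) * θ.ε₂₉) +
        ((((F.P P.K).d + 2) * (F.P P.K).L : ℕ) : ℝ) ^ 2 / 4 * (2 * θ.ν.εreg / ((F.P P.K).L : ℝ) ^ 2)) * ((F.P P.K).L : ℝ) ^ ((F.P P.K).d - 1) < deltaSU (Fin N))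
    {α : ℝ} (hαB : ((((F.P P.K).d + 2) * (F.P P.K).L : ℕ) : ℝ) ^ 2 / 4 *
      (2 * θ.ν.εreg / ((F.P P.K).L : ℝ) ^ 2 + 4 * max θ.ε₂₉ (10 * (((((F.P P.K).d + 2) * (F.P P.K).L : ℕ) : ℝ) * θ.ε₂₉) * ((F.P P.K).L : ℝ) ^ ((F.P P.K).d - 1))) < α)
    (hα24 : α ≤ 1 / 24) (hαδ : α < deltaSU (Fin N)) (hαL : 157 * α < (((F.P P.K).L : ℝ) ^ ((F.P P.K).d - 1))⁻¹)
    (hord : 2 * θ.ν.εreg / ((F.P P.K).L : ℝ) ^ 2 +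
      4 * max θ.ε₂₉ (10 * (((((F.P P.K).d + 2) * (F.P P.K).L : ℕ) : ℝ) * θ.ε₂₉) * ((F.P P.K).L : ℝ) ^ ((F.P P.K).d - 1)) < θ.ν.ε₀)
    (hρm : ∀ j < P.K, Measurable (betaInputOfRecord F N (TβOfRecord₁₃ F N) (chiβOfRecord₁₃ F N θ) P.K (gOfRecord₁₃ F N θ P) j))
    (hint : ∀ j < P.K, Integrable (betaInputOfRecord F N (TβOfRecord₁₃ F N) (chiβOfRecord₁₃ F N θ) P.K (gOfRecord₁₃ F N θ P) j) (fieldMeasure (F.P P.K) j (SU N)))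
    (hsolν : ∀ j < P.K, ∀ W ∈ domAltOfRecord F N θ.ν P.K (j + 1), UkExists F N P.K (j + 1) θ.ν.εreg W)
    (hcrit : ∀ j < P.K, ContinuousOn (critCfgOfRecord F N θ.ν P.K j) (domAltOfRecord F N θ.ν P.K (j + 1)))
    (hGF : ∀ j < P.K, ContinuousOn (gfOfRecord F N P.K j) (domAltOfRecord F N θ.ν P.K j)) :
    ∀ j < P.K, ∀ V ∈ domAltOfRecord F N θ.ν P.K (j + 1),
      0 < TβOfRecord₁₃ F N P.K j (betaInputOfRecord F N (TβOfRecord₁₃ F N) (chiβOfRecord₁₃ F N θ) P.K (gOfRecord₁₃ F N θ P) j) V :=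
  fun j hj => (hreg_pos_all_of_localSupportSet θ P.K (gOfRecord₁₃ F N θ P) hεreg hε3 hε2 hε29 hn1 hn2 hαB hα24 hαδ hαL hord hρm hint hsolν hcrit hGF j hj).2

/-- **★★ EVERY NORMALISATION CONSTANT `𝐍_j = T_jρ_j(1)` IS POSITIVE and (0.19) HOLDS ON EVERY DOMAIN** (`1 ∈ domAlt_{j+1}` when `0 < ν.ε₀`, K0e's `one_mem_domAltOfRecord`; lit-balaban r20's
`normConst_mul_exp_nextAction`). [cite: Balaban1987RG1, (0.19) p.255–256 and p.259] -/
theorem normConst_pos_and_eq_exp_of_localRoute (hε₀ : 0 < θ.ν.ε₀) (hεreg : 0 < θ.ν.εreg)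
    (hε3 : (143 * (((((F.P P.K).d + 4 : ℕ) : ℝ)) ^ 2 / 4) ^ 2) * θ.ν.εreg ≤ 1 / 3)
    (hε2 : 2 * θ.ν.εreg ≤ 2 * deltaSU (Fin N) / ((((F.P P.K).d + 4) * (F.P P.K).L : ℕ) : ℝ) ^ 2) (hε29 : 0 < θ.ε₂₉)
    (hn1 : 1640 * (2 * (((((F.P P.K).d + 2) * (F.P P.K).L : ℕ) : ℝ) * θ.ε₂₉) +
        ((((F.P P.K).d + 2) * (F.P P.K).L : ℕ) : ℝ) ^ 2 / 4 * (2 * θ.ν.εreg / ((F.P P.K).L : ℝ) ^ 2)) * (((F.P P.K).L : ℝ) ^ ((F.P P.K).d - 1)) ^ 2 ≤ 1)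
    (hn2 : 13 * (2 * (((((F.P P.K).d + 2) * (F.P P.K).L : ℕ) : ℝ) * θ.ε₂₉) +
        ((((F.P P.K).d + 2) * (F.P P.K).L : ℕ) : ℝ) ^ 2 / 4 * (2 * θ.ν.εreg / ((F.P P.K).L : ℝ) ^ 2)) * ((F.P P.K).L : ℝ) ^ ((F.P P.K).d - 1) < deltaSU (Fin N))
    {α : ℝ} (hαB : ((((F.P P.K).d + 2) * (F.P P.K).L : ℕ) : ℝ) ^ 2 / 4 *
      (2 * θ.ν.εreg / ((F.P P.K).L : ℝ) ^ 2 + 4 * max θ.ε₂₉ (10 * (((((F.P P.K).d + 2) * (F.P P.K).L : ℕ) : ℝ) * θ.ε₂₉) * ((F.P P.K).L : ℝ) ^ ((F.P P.K).d - 1))) < α)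
    (hα24 : α ≤ 1 / 24) (hαδ : α < deltaSU (Fin N)) (hαL : 157 * α < (((F.P P.K).L : ℝ) ^ ((F.P P.K).d - 1))⁻¹)
    (hord : 2 * θ.ν.εreg / ((F.P P.K).L : ℝ) ^ 2 +
      4 * max θ.ε₂₉ (10 * (((((F.P P.K).d + 2) * (F.P P.K).L : ℕ) : ℝ) * θ.ε₂₉) * ((F.P P.K).L : ℝ) ^ ((F.P P.K).d - 1)) < θ.ν.ε₀)
    (hρm : ∀ j < P.K, Measurable (betaInputOfRecord F N (TβOfRecord₁₃ F N) (chiβOfRecord₁₃ F N θ) P.K (gOfRecord₁₃ F N θ P) j))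
    (hint : ∀ j < P.K, Integrable (betaInputOfRecord F N (TβOfRecord₁₃ F N) (chiβOfRecord₁₃ F N θ) P.K (gOfRecord₁₃ F N θ P) j) (fieldMeasure (F.P P.K) j (SU N)))
    (hsolν : ∀ j < P.K, ∀ W ∈ domAltOfRecord F N θ.ν P.K (j + 1), UkExists F N P.K (j + 1) θ.ν.εreg W)
    (hcrit : ∀ j < P.K, ContinuousOn (critCfgOfRecord F N θ.ν P.K j) (domAltOfRecord F N θ.ν P.K (j + 1)))
    (hGF : ∀ j < P.K, ContinuousOn (gfOfRecord F N P.K j) (domAltOfRecord F N θ.ν P.K j)) :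
    ∀ j < P.K, 0 < normConstHT F N (TβOfRecord₁₃ F N) (chiβOfRecord₁₃ F N θ) P.K (gOfRecord₁₃ F N θ P) j ∧
      ∀ V ∈ domAltOfRecord F N θ.ν P.K (j + 1),
        TβOfRecord₁₃ F N P.K j (betaInputOfRecord F N (TβOfRecord₁₃ F N) (chiβOfRecord₁₃ F N θ) P.K (gOfRecord₁₃ F N θ P) j) V
          = normConstHT F N (TβOfRecord₁₃ F N) (chiβOfRecord₁₃ F N θ) P.K (gOfRecord₁₃ F N θ P) j *
            Real.exp (effActionHT F N (TβOfRecord₁₃ F N) (chiβOfRecord₁₃ F N θ) P.K (gOfRecord₁₃ F N θ P) (j + 1) V) := by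
  intro j hj
  have hpos := pos_of_localRoute θ P hεreg hε3 hε2 hε29 hn1 hn2 hαB hα24 hαδ hαL hord hρm hint hsolν hcrit hGF j hj
  have hN : 0 < normConstHT F N (TβOfRecord₁₃ F N) (chiβOfRecord₁₃ F N θ) P.K (gOfRecord₁₃ F N θ P) j :=
    hpos 1 (one_mem_domAltOfRecord θ.ν hε₀ P.K (j + 1))
  refine ⟨hN, fun V hV => ?_⟩
  rw [effActionHT_succ]
  exact (normConst_mul_exp_nextAction _ _ _ _ _ hN (hpos V hV)).symm

end Record

/-! ## §3 dag-n09-w4 g3's small-field-bookkeeping door with `hreg` REPLACED by (H-U), `hsolν`, on-domain hcrit and numerics (`GF_j` supplied by dag-n09-w1 g5) -/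

section Door

variable (θ : Stage13HParams F N) (h : θ.Provisos₁₃SepCoPH F N) {w : WorldP} (P : B12.RunParams)

/-- **★★★ N09's THEOREM-3 MEMBER AT THE STAGE-13 RECORD ON THE LOCAL ROUTE** (dag-n09-w4 g3's `…N09B0RiderAtRecord.thm3Member_stage13SepCoPH_atDomAlt_of_numerics_of_εreg_eq` with
`hreg := hreg_of_localRoute …`, and `GF_j`'s continuity on the domains by dag-n09-w1 g5's `continuousOn_gfOfRecord_domAlt`): N09-side inputs = (181)ˢᵒˡ `hcov`, `hsolν` + [B11] ×3 at one radius
(N07), (I19) `hint`, (H-U) `hρm`, the critical configurations continuous ON the next domains (`hcrit`), and NUMERICS (the door's + the local support set's `hαB`, α-range, STRICT `hord'`, and `GF`'s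
`((d·L)²∕4)·ε₀ < δ_Fed`).  CONDITIONAL; nothing of Bałaban's asserted; N09 NOT discharged.
[cite: Balaban1987RG1, Thm 3 p.264, p.259, (0.11) p.253, (0.17)–(0.19) p.255, (2.9) p.266, (2.10) p.267; Balaban1985Variational, Thm 1 (8)–(10) p.279 and (181) p.307] -/
theorem thm3Member_stage13SepCoPH_atDomAlt_of_localRoute_of_numerics_of_εreg_eq
    (hC : w.C = (datumOfRecord₁₃SepCoPH F N θ h).C) (hε : 0 < θ.ε₂₉) (heq : θ.toStage13Params.ν.εreg = θ.εbg)
    (hεreg : 0 < θ.toStage13Params.ν.εreg)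
    (hε3 : (143 * (((((F.P P.K).d + 4 : ℕ) : ℝ)) ^ 2 / 4) ^ 2) * θ.toStage13Params.ν.εreg ≤ 1 / 3)
    (hε2 : 2 * θ.toStage13Params.ν.εreg ≤ 2 * deltaSU (Fin N) / ((((F.P P.K).d + 4) * (F.P P.K).L : ℕ) : ℝ) ^ 2)
    (hord : 2 * θ.toStage13Params.ν.εreg / ((F.P P.K).L : ℝ) ^ 2 +
      4 * max θ.toStage13Params.ε₂₉ (10 * (((((F.P P.K).d + 2) * (F.P P.K).L : ℕ) : ℝ) * θ.toStage13Params.ε₂₉) * ((F.P P.K).L : ℝ) ^ ((F.P P.K).d - 1)) ≤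
        θ.toStage13Params.ν.ε₀)
    (hn1 : 1640 * (2 * (((((F.P P.K).d + 2) * (F.P P.K).L : ℕ) : ℝ) * θ.toStage13Params.ε₂₉) +
        ((((F.P P.K).d + 2) * (F.P P.K).L : ℕ) : ℝ) ^ 2 / 4 * (2 * θ.toStage13Params.ν.εreg / ((F.P P.K).L : ℝ) ^ 2)) *
          (((F.P P.K).L : ℝ) ^ ((F.P P.K).d - 1)) ^ 2 ≤ 1)
    (hn2 : 13 * (2 * (((((F.P P.K).d + 2) * (F.P P.K).L : ℕ) : ℝ) * θ.toStage13Params.ε₂₉) +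
        ((((F.P P.K).d + 2) * (F.P P.K).L : ℕ) : ℝ) ^ 2 / 4 * (2 * θ.toStage13Params.ν.εreg / ((F.P P.K).L : ℝ) ^ 2)) *
          ((F.P P.K).L : ℝ) ^ ((F.P P.K).d - 1) < deltaSU (Fin N))
    (hcov : ∀ j < P.K, ∀ (v : GaugeTransf (F.P P.K) (j + 1) (SU N)) (W : GaugeField (F.P P.K) (j + 1) (SU N)),
      UkExists F N P.K (j + 1) θ.toStage13Params.ν.εreg W →
        critCfgOfRecord F N θ.toStage13Params.ν P.K j (gaugeAct v W) = gaugeAct (liftTransf v) (critCfgOfRecord F N θ.toStage13Params.ν P.K j W))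
    (hsolν : ∀ j < P.K, ∀ W ∈ domAltOfRecord F N θ.ν P.K (j + 1), UkExists F N P.K (j + 1) θ.toStage13Params.ν.εreg W)
    (hint : ∀ j < P.K, Integrable (betaInputOfRecord F N (TβOfRecord₁₃ F N) (chiβOfRecord₁₃ F N θ.toStage13Params) P.K (gOfRecord₁₃ F N θ.toStage13Params P) j)
      (fieldMeasure (F.P P.K) j (SU N)))
    -- the LOCAL data replacing `hreg`
    (hρm : ∀ j < P.K, Measurable (betaInputOfRecord F N (TβOfRecord₁₃ F N) (chiβOfRecord₁₃ F N θ.toStage13Params) P.K (gOfRecord₁₃ F N θ.toStage13Params P) j))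
    (hcrit : ∀ j < P.K, ContinuousOn (critCfgOfRecord F N θ.toStage13Params.ν P.K j) (domAltOfRecord F N θ.ν P.K (j + 1)))
    {α : ℝ} (hαB : ((((F.P P.K).d + 2) * (F.P P.K).L : ℕ) : ℝ) ^ 2 / 4 *
      (2 * θ.toStage13Params.ν.εreg / ((F.P P.K).L : ℝ) ^ 2 +
        4 * max θ.toStage13Params.ε₂₉ (10 * (((((F.P P.K).d + 2) * (F.P P.K).L : ℕ) : ℝ) * θ.toStage13Params.ε₂₉) * ((F.P P.K).L : ℝ) ^ ((F.P P.K).d - 1))) < α)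
    (hα24 : α ≤ 1 / 24) (hαδ : α < deltaSU (Fin N)) (hαL : 157 * α < (((F.P P.K).L : ℝ) ^ ((F.P P.K).d - 1))⁻¹)
    (hord' : 2 * θ.toStage13Params.ν.εreg / ((F.P P.K).L : ℝ) ^ 2 +
      4 * max θ.toStage13Params.ε₂₉ (10 * (((((F.P P.K).d + 2) * (F.P P.K).L : ℕ) : ℝ) * θ.toStage13Params.ε₂₉) * ((F.P P.K).L : ℝ) ^ ((F.P P.K).d - 1)) <
        θ.toStage13Params.ν.ε₀)
    (hε₀ : 0 ≤ θ.toStage13Params.ν.ε₀) (hfed : ((((F.P P.K).d * (F.P P.K).L : ℕ) : ℝ)) ^ 2 / 4 * θ.toStage13Params.ν.ε₀ < deltaFed (Fin N))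
    (h11 : ∀ k, k ≤ P.K → ∀ V ∈ domAltOfRecord F N θ.ν P.K k, UkExists F N P.K k θ.εbg V ∧ UniqueUkOrbit F N P.K k θ.εbg V)
    (hres : ∀ k, k ≤ P.K → HRestrict F N θ.εbg P.K k (domAltOfRecord F N θ.ν P.K k))
    (huniq : ∀ k, k ≤ P.K → ∀ V ∈ domAltOfRecord F N θ.ν P.K k, ∀ j < k,
      UniqueUkOrbit F N P.K (j + 1) θ.εbg (Averaging.iter (avOfRecord F N P.K) (j + 1) (Uk F N P.K k θ.εbg V))) :
    (leavesP w P).smallCouplings → (leavesP w P).smallFieldInductive :=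
  have hGF : ∀ j < P.K, ContinuousOn (gfOfRecord F N P.K j) (domAltOfRecord F N θ.ν P.K j) := fun j hj =>
    continuousOn_gfOfRecord_domAlt θ.toStage13Params.ν (by simp only [T4Continuum.T4Family.P_K]; omega) hε₀ hfed
  thm3Member_stage13SepCoPH_atDomAlt_of_numerics_of_εreg_eq θ h hC P hε heq hεreg hε3 hε2 hord hn1 hn2 hcov hsolν hint
    (hreg_of_localRoute θ.toStage13Params P hεreg hε3 hε2 hε hn1 hn2 hαB hα24 hαδ hαL hord' hρm hint hsolν hcrit hGF) h11 hres huniq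

end Door

end Summit.QuantumFields.YangMills.BalabanUVNodes.N09RegularityTowerOfLocalRoute

end
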